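import Summits.HodgeConjecture.HodgeConjecture.Theorems.F0P3GHSideOfFibres                 -- ★ (F0P3-p04 (g9), K9-0a(a)): `ghOfFibres`, `matchingS_kitOfRecord_ghOfFibres`, `transferS_kitOfRecord_ghOfFibres` (+ ★ `F0P3KitOfRecordLawsV8`: `SpecPkg`, `FactorisationPk`)
import Summits.HodgeConjecture.HodgeConjecture.Theorems.F0P3bLocalExpansionAtKitOfRecord    -- ★ (F0P3b desk): `GTraceProductForm`, `HTraceProductForm`, `localExpansion_kitOfRecord`
import Summits.HodgeConjecture.HodgeConjecture.Theorems.F0P3ClassificationBridgeV8           -- ★ (F0P3-p03 (g7)): `localExpansion_of_v6`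
import HarnessLib

/-!
# Crux `H413`, ROAD «K9-∞», row K9-5 — THE WITNESSED PACKAGE `SpecPkg S₀` OF THE KIT OF RECORD FROM THE RESIDUAL PRINT LETTER «K9-STF» (socket level)

Cell `hodgecm-mathlib`, F0∕P3a, crux H413 (`stmt-HodgeConjecture-24833`); F0P3a-p01 (g11) on LEAD F0P3a-plan (g8) WORD T7-27 «K9-5 — OVERRIDE WITNESS OF LETTERS», census
`F0/P3a/F0P3a-p01/g11/CENSUS-K9-5-OverrideWitnessOfLetters.F0P3a-p01g11.md`.  PROOF lane: theorems only; no `def`, no instance, no notation, no named fact, no `sorry`;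
`--supports stmt-HodgeConjecture-24833`.  Count-neutral (bookkeeping; the printed statements stay hypotheses, cited at their binders).

WHAT THIS FILE IS FOR.  The rung-0 closer's K9 letter (`Cruxes/H413/Lines/F0_U3LettersRung1.lean` §B, `stub_K9`) posits `Nonempty (OverrideWitness … 𝔨)`; its field
`specPkg : SpecPkg (kitK9 … 𝔨 ov gh evpG evpH ramG ramH PiXi ρXi) S₀` bundles five v8 laws of the kit of record [Rogawski1990 Thm. 14.6.1 p. 241, Thm. 14.6.4 p. 244,
(14.2.1) p. 232; Flath1979 Thm. 3].  With the G∕H side OF FIBRES (★ `ghOfFibres`, K9-0a(a)) two of them are theorems (`matchingS`, `transferS`), and with the F0P3b desk's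
★ `localExpansion_kitOfRecord` a third one (`localExpansion`, the two-term expansion (14.6.3)) follows from the sign clause `c = ±1` and the two PRODUCT-TRACE clauses
★ `GTraceProductForm` ∕ ★ `HTraceProductForm` (the `S`-level traces of `Π(ξ)` and of `ξ` ARE the signed ∕ unsigned products of the local A-packet characters at `f′_S`
[Rogawski1990 13.1.3 (b), Prop. 13.1.4 p. 199; 12.3.3 p. 178; Props. 14.4.1 (a), 14.4.2 (c); p. 244 ll. 6–17]).  So the residual PRINT content of `specPkg` is exactly
`FactorisationPk` [Flath1979 Thm. 3; CartierCorvallis1979 §IV; Rogawski1990 §13.2, §13.7] + `APacketSpectral` [Thm. 13.3.5, 13.3.7; §13.3] + the two product-trace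
clauses — the (P)-part of the letter «K9-STF» — and this file ASSEMBLES `SpecPkg … S₀` from them, at the socket level (any `𝔰 : Sockets L H μ`, any ξ-side `ξd`; no `𝔨`,
no `SpecOverride`, no `OverrideWitness` — those are Lines-side; the closer instantiates `𝔰 := socketsOfT1 (𝔨.override ov)`, `ξd := xiSideOfRecord …`).
* `gTraceProductForm_ghOfFibres_of_forall` ∕ `hTraceProductForm_ghOfFibres_of_forall` (§1): at `gh := ghOfFibres …` the `S`-level matching relation is EQUALITY of the
  `G′`-side data, so the product-trace clauses reduce to their one-variable forms `∀ fS, trGS S (PiXi ξ) fS = …` ∕ `∀ fS, trHS S (ρXi ξ) fS = …` (the shape a letter states);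
* **`specPkg_kitOfRecord_ghOfFibres_of_productForm`** (§2): `SpecPkg 𝔠₀ S₀` from `hc : c = 1 ∨ c = -1`, `FactorisationPk 𝔠₀ S₀`, `APacketSpectral 𝔠₀ S₀` and the two
  product-trace clauses, `𝔠₀ := kitOfRecord L H ι T hT μ 𝔰 (ghOfFibres ι T hT 𝔰 hg hsm trGS trHS) ξd μω c jInf dsInf archTr ν μv ramCls₀`;
* `specPkg_kitOfRecord_ghOfFibres_of_localExpansion` (§2): the same with `LocalExpansion 𝔠₀ S₀` passed through instead (for a letter that keeps (14.6.3) by name).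
HONEST LABEL: HC_CM is proved only modulo the printed citations until rung 0 closes.

References: [Rogawski1990] §13.1 p. 199, §13.2, §13.3 Thms. 13.3.5∕13.3.7, §13.7 p. 210, §14.2 (14.2.1) p. 232, §14.6 Thm. 14.6.1 p. 241, Thm. 14.6.4 (14.6.3) p. 244;
[Flath1979] Thm. 3; [CartierCorvallis1979] §IV.1.
-/

set_option autoImplicit false
set_option linter.dupNamespace false

noncomputable section

open NumberField IsDedekindDomain MeasureTheory
open Literature.NumberTheory.Rogawski1990 Literature.NumberTheory.GaloisRepresentations
open Literature.NumberTheory.Automorphic Literature.NumberTheory.Automorphic.UnitaryGroup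
open scoped Matrix ComplexOrder BigOperators Classical

namespace Summit.HodgeConjecture.HodgeConjecture.Cruxes.H413.F0P3OverrideWitnessOfLetters

open Summit.HodgeConjecture.HodgeConjecture.Cruxes.H413.F0P3InnerFormClassificationV6 (Gp Places Cinf Sockets TestGp TestG TestH)
open Summit.HodgeConjecture.HodgeConjecture.Cruxes.H413.F0P3InnerFormClassificationV6.ClassificationKit (memberCoeff)
open Summit.HodgeConjecture.HodgeConjecture.Cruxes.H413.F0P3KitOfRecord (GHSide XiSide kitOfRecord cptXi₀)
open Summit.HodgeConjecture.HodgeConjecture.Cruxes.H413.F0P3TestFunctionsOfRecord (Unr₀)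
open Summit.HodgeConjecture.HodgeConjecture.Cruxes.H413.F0P3SemilocalTestFunctionsOfRecord (TestS₀ tens₀)
open Summit.HodgeConjecture.HodgeConjecture.Cruxes.H413.F0P3XiArchDataOfRecord (nCompactOfRecord)
open Summit.HodgeConjecture.HodgeConjecture.Cruxes.H413.F0P3XiArchPacketOfRecord (archPacketOfRecord)
open Summit.HodgeConjecture.HodgeConjecture.Cruxes.H413.F0P3GHSideOfFibres (ghOfFibres matchingS_kitOfRecord_ghOfFibres transferS_kitOfRecord_ghOfFibres)
open Summit.HodgeConjecture.HodgeConjecture.Cruxes.H413.F0P3bLocalExpansionAtKitOfRecord (GTraceProductForm HTraceProductForm localExpansion_kitOfRecord)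
open Summit.HodgeConjecture.HodgeConjecture.Cruxes.H413.F0P3InnerFormClassificationV8.ClassificationKit (localExpansion_of_v6)

variable (L : Type) [Field L] [NumberField L] [IsCMField L] (H : Matrix (Fin 3) (Fin 3) L) (ι : L →+* ℂ) (T : GL (Fin 3) ℂ)
  (hT : (T : Matrix (Fin 3) (Fin 3) ℂ)ᴴ * H.map ι * (T : Matrix (Fin 3) (Fin 3) ℂ) = Literature.Geometry.ComplexHyperbolic.BallModel.J)
  (μ : Measure (Gp L H).automorphicQuotient) [(Gp L H).IsAutomorphicMeasure μ]

variable {L H μ}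
variable (𝔰 : Sockets L H μ) (hg : ∀ f' : TestGp L H, 𝔰.Smooth f' → ∃ (f : TestG L) (fH : TestH L), 𝔰.Matches f' f fH)
  (hsm : ∀ (S : Finset (Places L)) (fS : TestS₀ L H ι T hT S) (fT : Unr₀ L H S), 𝔰.Smooth (tens₀ S fS fT))
  (trGS : ∀ S : Finset (Places L), 𝔰.PacketG → TestS₀ L H ι T hT S → ℂ) (trHS : ∀ S : Finset (Places L), 𝔰.PacketH → TestS₀ L H ι T hT S → ℂ)
  (ξd : XiSide L H 𝔰.PacketG 𝔰.PacketH) (μω : HeckeCharacter L) (c : ℚ) (jInf dsInf : ℤ → ℤ → ℤ → Cinf)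
  (archTr : Cinf → (UnitaryGroup.arch (↥(maximalRealSubfield L)) L (IsCMField.complexConj L) 3 H → ℂ) → ℂ)
  (μv : ∀ v : Places L, @Measure ((cmDatum L 3 H).Local v) (borel _))

/-! ## §1 The product-trace clauses at the G∕H side of fibres: one-variable forms -/

/-- **`GTraceProductForm` at `gh := ghOfFibres …` from its one-variable form.**  At the G∕H side of fibres the `S`-level matching relation is `fSG = fS ∧ fSH = fS`, so the
G-side product-trace clause [Rogawski1990 13.1.3 (b) p. 199; 12.3.3 (b) p. 178; p. 244] is implied by (indeed equivalent to) «for every `ξ`, `S ⊇ ram ξ` and `G′`-side datum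
`f_S`: `Tr Π(ξ)_S(f_S) = [F_ξ = 𝟙] · (−1)^N · (Σ_y coeff⁻(y) A_y(f_∞)) · ∏_{v ∈ S} Σ_z coeff⁻_v(z) Tr z(f_v)`». [cite: Rogawski1990, §13.1 13.1.3 (b) p. 199; §12.3 12.3.3 (b) p. 178; §14.6 p. 244] -/
theorem gTraceProductForm_ghOfFibres_of_forall
    (h : ∀ (ξ : OneDimAutRepH L) (S : Finset (Places L)), ξd.ram ξ ⊆ S → ∀ (fS : TestS₀ L H ι T hT S),
      trGS S (ξd.PiXi ξ) fS = (if cptXi₀ ι μω ξ then 1 else 0) * (-1) ^ nCompactOfRecord L *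
        ((∑ᶠ y, (memberCoeff (archPacketOfRecord ι μω jInf dsInf ξ) (-1) y : ℂ) * archTr y fS.arch) *
          ∏ v : ↥S, ∑ᶠ z, (memberCoeff (ξd.packFin ξ v.1) (-1) z : ℂ) *
            (letI : MeasurableSpace ((cmDatum L 3 H).Local v.1) := borel _; z.smoothTrace (μv v.1) (fS.loc v)))) :
    GTraceProductForm ι T hT (ghOfFibres ι T hT 𝔰 hg hsm trGS trHS) ξd μω jInf dsInf archTr μv := by
  intro ξ S hS fS fSG fSH hm
  obtain ⟨h1, -⟩ := hm
  rw [h1]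
  exact h ξ S hS fS

/-- **`HTraceProductForm` at `gh := ghOfFibres …` from its one-variable form** — «for every `ξ`, `S ⊇ ram ξ` and `G′`-side datum `f_S`: `Tr ξ_S(f^H_S) = [F_ξ = 𝟙] · (−1)^N · c ·
(Σ_y coeff⁺(y) A_y(f_∞)) · ∏_{v ∈ S} Σ_z coeff⁺_v(z) Tr z(f_v)`» (the endoscopic character identities). [cite: Rogawski1990, §13.1 Prop. 13.1.4 p. 199; §12.3 12.3.3 (a) p. 178; §14.6 p. 243 l. 9 – p. 244 l. 17] -/
theorem hTraceProductForm_ghOfFibres_of_forall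
    (h : ∀ (ξ : OneDimAutRepH L) (S : Finset (Places L)), ξd.ram ξ ⊆ S → ∀ (fS : TestS₀ L H ι T hT S),
      trHS S (ξd.ρXi ξ) fS = (if cptXi₀ ι μω ξ then 1 else 0) * (-1) ^ nCompactOfRecord L * (c : ℂ) *
        ((∑ᶠ y, (memberCoeff (archPacketOfRecord ι μω jInf dsInf ξ) 1 y : ℂ) * archTr y fS.arch) *
          ∏ v : ↥S, ∑ᶠ z, (memberCoeff (ξd.packFin ξ v.1) 1 z : ℂ) *
            (letI : MeasurableSpace ((cmDatum L 3 H).Local v.1) := borel _; z.smoothTrace (μv v.1) (fS.loc v)))) :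
    HTraceProductForm ι T hT (ghOfFibres ι T hT 𝔰 hg hsm trGS trHS) ξd μω c jInf dsInf archTr μv := by
  intro ξ S hS fS fSG fSH hm
  obtain ⟨-, h2⟩ := hm
  rw [h2]
  exact h ξ S hS fS

/-! ## §2 `SpecPkg S₀` of the kit of record with the G∕H side of fibres, from the residual print clauses -/

variable [MeasurableSpace (Gp L H).Adelic] [BorelSpace (Gp L H).Adelic]
variable (ν : Measure (Gp L H).Adelic) [IsFiniteMeasureOnCompacts ν] (ramCls₀ : DiscreteAutomorphicRep (Gp L H) μ → Set (Places L))

/-- **`SpecPkg 𝔠₀ S₀` FROM THE LETTER'S (P)-CLAUSES** — `𝔠₀ := kitOfRecord … 𝔰 (ghOfFibres …) ξd …`: `factorisationPk` and `aPacketSpectral` are passed through (print: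
[Flath1979 Thm. 3; CartierCorvallis1979 §IV; Rogawski1990 §13.2, §13.7; Thm. 13.3.5, 13.3.7]); `matchingS` ∕ `transferS` hold BY CONSTRUCTION (★ K9-0a(a)); `localExpansion` is the
F0P3b desk's ★ `localExpansion_kitOfRecord` fed with the sign clause `c = ±1` [p. 243 l. 9 – p. 244 l. 4] and the two product-trace clauses, lifted v6 → v8 (★ `localExpansion_of_v6`).
[cite: Rogawski1990, §14.6 Thm. 14.6.1 p. 241; Thm. 14.6.4 (14.6.3) p. 244; §13.3 Thm. 13.3.7] [cite: FlathCorvallis1979, Thm. 3] -/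
theorem specPkg_kitOfRecord_ghOfFibres_of_productForm (S₀ : Finset (Places L)) (hc : c = 1 ∨ c = -1)
    (hP1 : F0P3InnerFormClassificationV8.ClassificationKit.FactorisationPk
      (kitOfRecord L H ι T hT μ 𝔰 (ghOfFibres ι T hT 𝔰 hg hsm trGS trHS) ξd μω c jInf dsInf archTr ν μv ramCls₀) S₀)
    (hP2 : F0P3InnerFormClassificationV8.ClassificationKit.APacketSpectral
      (kitOfRecord L H ι T hT μ 𝔰 (ghOfFibres ι T hT 𝔰 hg hsm trGS trHS) ξd μω c jInf dsInf archTr ν μv ramCls₀) S₀)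
    (hG : GTraceProductForm ι T hT (ghOfFibres ι T hT 𝔰 hg hsm trGS trHS) ξd μω jInf dsInf archTr μv)
    (hH : HTraceProductForm ι T hT (ghOfFibres ι T hT 𝔰 hg hsm trGS trHS) ξd μω c jInf dsInf archTr μv) :
    F0P3InnerFormClassificationV8.ClassificationKit.SpecPkg
      (kitOfRecord L H ι T hT μ 𝔰 (ghOfFibres ι T hT 𝔰 hg hsm trGS trHS) ξd μω c jInf dsInf archTr ν μv ramCls₀) S₀ :=
  ⟨hP1, matchingS_kitOfRecord_ghOfFibres ι T hT 𝔰 hg hsm trGS trHS ξd μω c jInf dsInf archTr ν μv ramCls₀ S₀,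
    transferS_kitOfRecord_ghOfFibres ι T hT 𝔰 hg hsm trGS trHS ξd μω c jInf dsInf archTr ν μv ramCls₀ S₀, hP2,
    localExpansion_of_v6 _ (localExpansion_kitOfRecord L H ι T hT μ 𝔰 (ghOfFibres ι T hT 𝔰 hg hsm trGS trHS) ξd μω c jInf dsInf archTr ν μv ramCls₀ hc hG hH) S₀⟩

/-- **`SpecPkg 𝔠₀ S₀` with (14.6.3) kept by name** — the same assembly for a letter that posits `LocalExpansion 𝔠₀ S₀` itself [Rogawski1990 Thm. 14.6.4 (14.6.3) p. 244] instead of the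
two product-trace clauses. [cite: Rogawski1990, §14.6 Thm. 14.6.1 p. 241; Thm. 14.6.4 (14.6.3) p. 244] [cite: FlathCorvallis1979, Thm. 3] -/
theorem specPkg_kitOfRecord_ghOfFibres_of_localExpansion (S₀ : Finset (Places L))
    (hP1 : F0P3InnerFormClassificationV8.ClassificationKit.FactorisationPk
      (kitOfRecord L H ι T hT μ 𝔰 (ghOfFibres ι T hT 𝔰 hg hsm trGS trHS) ξd μω c jInf dsInf archTr ν μv ramCls₀) S₀)
    (hP2 : F0P3InnerFormClassificationV8.ClassificationKit.APacketSpectral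
      (kitOfRecord L H ι T hT μ 𝔰 (ghOfFibres ι T hT 𝔰 hg hsm trGS trHS) ξd μω c jInf dsInf archTr ν μv ramCls₀) S₀)
    (hP3 : F0P3InnerFormClassificationV8.ClassificationKit.LocalExpansion
      (kitOfRecord L H ι T hT μ 𝔰 (ghOfFibres ι T hT 𝔰 hg hsm trGS trHS) ξd μω c jInf dsInf archTr ν μv ramCls₀) S₀) :
    F0P3InnerFormClassificationV8.ClassificationKit.SpecPkg
      (kitOfRecord L H ι T hT μ 𝔰 (ghOfFibres ι T hT 𝔰 hg hsm trGS trHS) ξd μω c jInf dsInf archTr ν μv ramCls₀) S₀ :=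
  ⟨hP1, matchingS_kitOfRecord_ghOfFibres ι T hT 𝔰 hg hsm trGS trHS ξd μω c jInf dsInf archTr ν μv ramCls₀ S₀,
    transferS_kitOfRecord_ghOfFibres ι T hT 𝔰 hg hsm trGS trHS ξd μω c jInf dsInf archTr ν μv ramCls₀ S₀, hP2, hP3⟩

/-- **The product-trace form with the one-variable clauses spelled out** (the shape the letter «K9-STF» states them in): `SpecPkg 𝔠₀ S₀` from `c = ±1`, `FactorisationPk`,
`APacketSpectral` and the two one-variable product-trace identities for `trGS S (PiXi ξ)` ∕ `trHS S (ρXi ξ)`.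
[cite: Rogawski1990, §13.1 13.1.3 (b), Prop. 13.1.4 p. 199; §12.3 p. 178; §14.6 Thm. 14.6.4 p. 244] [cite: FlathCorvallis1979, Thm. 3] -/
theorem specPkg_kitOfRecord_ghOfFibres_of_forall (S₀ : Finset (Places L)) (hc : c = 1 ∨ c = -1)
    (hP1 : F0P3InnerFormClassificationV8.ClassificationKit.FactorisationPk
      (kitOfRecord L H ι T hT μ 𝔰 (ghOfFibres ι T hT 𝔰 hg hsm trGS trHS) ξd μω c jInf dsInf archTr ν μv ramCls₀) S₀)
    (hP2 : F0P3InnerFormClassificationV8.ClassificationKit.APacketSpectral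
      (kitOfRecord L H ι T hT μ 𝔰 (ghOfFibres ι T hT 𝔰 hg hsm trGS trHS) ξd μω c jInf dsInf archTr ν μv ramCls₀) S₀)
    (hGf : ∀ (ξ : OneDimAutRepH L) (S : Finset (Places L)), ξd.ram ξ ⊆ S → ∀ (fS : TestS₀ L H ι T hT S),
      trGS S (ξd.PiXi ξ) fS = (if cptXi₀ ι μω ξ then 1 else 0) * (-1) ^ nCompactOfRecord L *
        ((∑ᶠ y, (memberCoeff (archPacketOfRecord ι μω jInf dsInf ξ) (-1) y : ℂ) * archTr y fS.arch) *
          ∏ v : ↥S, ∑ᶠ z, (memberCoeff (ξd.packFin ξ v.1) (-1) z : ℂ) *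
            (letI : MeasurableSpace ((cmDatum L 3 H).Local v.1) := borel _; z.smoothTrace (μv v.1) (fS.loc v))))
    (hHf : ∀ (ξ : OneDimAutRepH L) (S : Finset (Places L)), ξd.ram ξ ⊆ S → ∀ (fS : TestS₀ L H ι T hT S),
      trHS S (ξd.ρXi ξ) fS = (if cptXi₀ ι μω ξ then 1 else 0) * (-1) ^ nCompactOfRecord L * (c : ℂ) *
        ((∑ᶠ y, (memberCoeff (archPacketOfRecord ι μω jInf dsInf ξ) 1 y : ℂ) * archTr y fS.arch) *
          ∏ v : ↥S, ∑ᶠ z, (memberCoeff (ξd.packFin ξ v.1) 1 z : ℂ) *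
            (letI : MeasurableSpace ((cmDatum L 3 H).Local v.1) := borel _; z.smoothTrace (μv v.1) (fS.loc v)))) :
    F0P3InnerFormClassificationV8.ClassificationKit.SpecPkg
      (kitOfRecord L H ι T hT μ 𝔰 (ghOfFibres ι T hT 𝔰 hg hsm trGS trHS) ξd μω c jInf dsInf archTr ν μv ramCls₀) S₀ :=
  specPkg_kitOfRecord_ghOfFibres_of_productForm ι T hT 𝔰 hg hsm trGS trHS ξd μω c jInf dsInf archTr μv ν ramCls₀ S₀ hc hP1 hP2
    (gTraceProductForm_ghOfFibres_of_forall ι T hT 𝔰 hg hsm trGS trHS ξd μω jInf dsInf archTr μv hGf)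
    (hTraceProductForm_ghOfFibres_of_forall ι T hT 𝔰 hg hsm trGS trHS ξd μω c jInf dsInf archTr μv hHf)

end Summit.HodgeConjecture.HodgeConjecture.Cruxes.H413.F0P3OverrideWitnessOfLetters

end
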